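import Summits.AtomisticToContinuum.HydrodynamicLimit.Theorems.ImplosionDichotomyPolynomialCompressionLevel3IntegratedRateAux
import Summits.AtomisticToContinuum.HydrodynamicLimit.Theorems.ImplosionDichotomyPolynomialCompressionLevel3Balance
import Summits.AtomisticToContinuum.HydrodynamicLimit.Theorems.ImplosionDichotomyPolynomialCompressionLevel3CoefficientEnvelope
import Summits.AtomisticToContinuum.HydrodynamicLimit.Theorems.ImplosionDichotomyPolynomialCompressionShadowingDefsHigher
import Summits.AtomisticToContinuum.HydrodynamicLimit.Theorems.ImplosionDichotomyPolynomialCompressionShadowRegularity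
import Summits.AtomisticToContinuum.HydrodynamicLimit.Theorems.ImplosionDichotomyPolynomialCompressionRelativeEnergyTwoEos
import Summits.AtomisticToContinuum.HydrodynamicLimit.Theorems.ImplosionDichotomyPolynomialCompressionSolutionAPI

/-!
# The integrated level-3 rate inequality (line `log-lipschitz-budget`, stub 4, level 3)

Helper file for the crux `ImplosionDichotomy.PolynomialCompression` (stmt-AtomisticToContinuum-12587), stub
`stub_logBudgetShadowing`. In the common setting `ShadowSetting` (with `ShadowEosHigher`) and the weak bootstrap regime
on `[0, t₀]` (constant `C_b = 1`, packing `1/(8(cZ+1))`), given sup bounds `S₀(s), S₁(s)` of the unweighted magnitudes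
`l3m0`, `l3m1` of `δV` and of its first derivatives, the level-3 energy `E₃ = shadowE3` obeys, at every `s ∈ [0, t₀)`,
`∫ ∂ₜ e₃(s,·) ≤ [Λ/(T₁ - s) + P(s)(S₀ + S₁ + cZ σ³)] E₃ + P(s)[√E₀ + √E₁ + (1 + S₀ + S₁ + cZ σ³)√E₂ + σ³] √E₃`
with `P(s) = κ (l3base … s)^a`: sum of `level3_pointwise_balance` over the words (solutions restricted to `[0, t₀)`,
`isHardSphereEulerSolution_restrict`, where the bootstrap hypotheses hold), divergence theorem, the envelope
`level3_coefficient_envelope`, Cauchy–Schwarz against the unweighted `L²` sizes (weights `≥ M⁻¹`), the sup bounds for the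
products of two small factors, and Nirenberg's `L⁴` interpolation for the products of two second derivatives
(`…Level3IntegratedRateSizes`, `…Level3IntegratedRateAux`).
-/

noncomputable section

namespace Summit.AtomisticToContinuum.HydrodynamicLimit.Theorems

open Set MeasureTheory
open Literature.MathematicalPhysics.KineticTheory Literature.Analysis.FunctionSpaces

/-- Smoothness and continuity of the slices of the level-3 objects at a time `s ∈ [0, T)`. [folklore] -/
private theorem l3ir_regular {σ T : ℝ} {ρ θ ρ₁ θ₁ : ℝ → T3 → ℝ} {u u₁ : ℝ → T3 → V3} {ζ : ℝ → ℝ} {J : Set ℝ}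
    (hE : IsHardSphereEulerSolution σ T ρ u θ) (hE₁ : IsHardSphereEulerSolution 0 T ρ₁ u₁ θ₁) (hJ : IsOpen J)
    (hζ : ContDiffOn ℝ (⊤ : ℕ∞) ζ J) (hρJ : ∀ t ∈ Ico 0 T, ∀ x, ρ t x ∈ J) {s : ℝ} (hs : s ∈ Ico 0 T) :
    Torus.IsSmooth (fun y => ρ s y - ρ₁ s y) ∧ Torus.IsSmooth (fun y => θ s y - θ₁ s y) ∧
    Torus.IsSmooth (fun y => u s y - u₁ s y) ∧
    (∀ l m n, Torus.IsSmoothSpaceTimeOn (Ico 0 T) (l3e ζ ρ θ ρ₁ θ₁ u u₁ l m n)) ∧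
    (∀ l m n i, Torus.IsSmooth (l3flux ζ ρ θ ρ₁ θ₁ u u₁ s l m n i)) ∧
    Torus.IsSmoothSpaceTimeOn (Ico 0 T) (l3e3 ζ ρ θ ρ₁ θ₁ u u₁) ∧
    Continuous (fun x => l3e3 ζ ρ θ ρ₁ θ₁ u u₁ s x) ∧
    Continuous (fun x => l3N3 ζ ρ θ ρ₁ θ₁ u u₁ s x) ∧ Continuous (fun x => l3m0 ρ θ ρ₁ θ₁ u u₁ s x) ∧
    Continuous (fun x => l3m1 ρ θ ρ₁ θ₁ u u₁ s x) ∧ Continuous (fun x => l3q ρ θ ρ₁ θ₁ u u₁ s x) ∧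
    Continuous (fun x => l3n ρ θ ρ₁ θ₁ u u₁ s x) := by
  have hU : UniqueDiffOn ℝ (Ico (0 : ℝ) T) := uniqueDiffOn_Ico 0 T
  have hdρ := hE.smooth_density.sub hE₁.smooth_density
  have hdθ := hE.smooth_temperature.sub hE₁.smooth_temperature
  have hdu := hE.smooth_velocity.sub hE₁.smooth_velocity
  have hρs := (hE.smooth_density.isSmooth_slice hs)
  have hθs := (hE.smooth_temperature.isSmooth_slice hs)
  have hδρ : Torus.IsSmooth (fun y => ρ s y - ρ₁ s y) := hdρ.isSmooth_slice hs
  have hδθ : Torus.IsSmooth (fun y => θ s y - θ₁ s y) := hdθ.isSmooth_slice hs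
  have hδu : Torus.IsSmooth (fun y => u s y - u₁ s y) := hdu.isSmooth_slice hs
  have hδuc : ∀ c, Torus.IsSmooth (fun y => u s y c - u₁ s y c) := fun c => by
    have e : (fun y => u s y c - u₁ s y c) = fun y => (u s y - u₁ s y) c := by
      funext y; rw [PiLp.sub_apply]
    rw [e]; exact hδu.apply c
  have hAst := isSmoothSpaceTimeOn_shadowWeightA hE hJ hζ hρJ
  have hBst := isSmoothSpaceTimeOn_shadowWeightB hE
  have hAc : Continuous (shadowWeightA ζ ρ θ s) := (hAst.isSmooth_slice hs).continuous
  have hBc : Continuous (shadowWeightB ρ θ s) := (hBst.isSmooth_slice hs).continuous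
  have hPc : Continuous (ρ s) := hρs.continuous
  -- words
  have hword : ∀ l m n, Torus.IsSmoothSpaceTimeOn (Ico 0 T) (l3e ζ ρ θ ρ₁ θ₁ u u₁ l m n) := fun l m n =>
    isSmoothSpaceTimeOn_frozenEnergy hE hJ hζ hρJ (((hdρ.partialDeriv hU l).partialDeriv hU m).partialDeriv hU n)
      (((hdu.partialDeriv hU l).partialDeriv hU m).partialDeriv hU n)
      (((hdθ.partialDeriv hU l).partialDeriv hU m).partialDeriv hU n)
  have hflux : ∀ l m n i, Torus.IsSmooth (l3flux ζ ρ θ ρ₁ θ₁ u u₁ s l m n i) := fun l m n i =>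
    (isSmoothSpaceTimeOn_frozenFlux hE hJ hζ hρJ (((hdρ.partialDeriv hU l).partialDeriv hU m).partialDeriv hU n)
      (((hdu.partialDeriv hU l).partialDeriv hU m).partialDeriv hU n)
      (((hdθ.partialDeriv hU l).partialDeriv hU m).partialDeriv hU n) i).isSmooth_slice hs
  have he3st : Torus.IsSmoothSpaceTimeOn (Ico 0 T) (l3e3 ζ ρ θ ρ₁ θ₁ u u₁) :=
    Torus.IsSmoothSpaceTimeOn.sum fun n _ => Torus.IsSmoothSpaceTimeOn.sum fun m _ =>
      Torus.IsSmoothSpaceTimeOn.sum fun l _ => hword l m n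
  have he3c : Continuous (fun x => l3e3 ζ ρ θ ρ₁ θ₁ u u₁ s x) := (he3st.isSmooth_slice hs).continuous
  -- continuity of the slices
  have c0u : ∀ c, Continuous fun x => u s x c - u₁ s x c := fun c => (hδuc c).continuous
  have c3ρ : ∀ a b d, Continuous fun x =>
      Torus.partialDeriv d (Torus.partialDeriv b (Torus.partialDeriv a (fun y => ρ s y - ρ₁ s y))) x :=
    fun a b d => (((hδρ.partialDeriv a).partialDeriv b).partialDeriv d).continuous
  have c3θ : ∀ a b d, Continuous fun x =>
      Torus.partialDeriv d (Torus.partialDeriv b (Torus.partialDeriv a (fun y => θ s y - θ₁ s y))) x :=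
    fun a b d => (((hδθ.partialDeriv a).partialDeriv b).partialDeriv d).continuous
  have c3u : ∀ a b d, Continuous fun x =>
      Torus.partialDeriv d (Torus.partialDeriv b (Torus.partialDeriv a (fun y => u s y - u₁ s y))) x :=
    fun a b d => (((hδu.partialDeriv a).partialDeriv b).partialDeriv d).continuous
  refine ⟨hδρ, hδθ, hδu, hword, hflux, he3st, he3c, ?_, ?_, ?_, ?_, ?_⟩
  · show Continuous fun x => ∑ n, ∑ m, ∑ l, (Real.sqrt (shadowWeightA ζ ρ θ s x) *
        |Torus.partialDeriv n (Torus.partialDeriv m (Torus.partialDeriv l (fun y => ρ s y - ρ₁ s y))) x| +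
      Real.sqrt (ρ s x) *
        ‖Torus.partialDeriv n (Torus.partialDeriv m (Torus.partialDeriv l (fun y => u s y - u₁ s y))) x‖ +
      Real.sqrt (shadowWeightB ρ θ s x) *
        |Torus.partialDeriv n (Torus.partialDeriv m (Torus.partialDeriv l (fun y => θ s y - θ₁ s y))) x|)
    fun_prop
  · show Continuous fun x => |ρ s x - ρ₁ s x| + |θ s x - θ₁ s x| + ∑ i, |u s x i - u₁ s x i|
    exact (hδρ.continuous.abs.add hδθ.continuous.abs).add (continuous_finsetSum _ fun i _ => (c0u i).abs)
  · show Continuous fun x => Torus.dsize₁ (fun y => ρ s y - ρ₁ s y) x + Torus.dsize₁ (fun y => θ s y - θ₁ s y) x +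
      ∑ c, Torus.dsize₁ (fun y => u s y c - u₁ s y c) x
    exact ((level3Rate_cont_dsize hδρ).1.add (level3Rate_cont_dsize hδθ).1).add
      (continuous_finsetSum _ fun c _ => (level3Rate_cont_dsize (hδuc c)).1)
  · show Continuous fun x => Torus.dsize₂ (fun y => ρ s y - ρ₁ s y) x + Torus.dsize₂ (fun y => θ s y - θ₁ s y) x +
      ∑ c, Torus.dsize₂ (fun y => u s y c - u₁ s y c) x
    exact ((level3Rate_cont_dsize hδρ).2.1.add (level3Rate_cont_dsize hδθ).2.1).add
      (continuous_finsetSum _ fun c _ => (level3Rate_cont_dsize (hδuc c)).2.1)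
  · show Continuous fun x => Torus.dsize₃ (fun y => ρ s y - ρ₁ s y) x + Torus.dsize₃ (fun y => θ s y - θ₁ s y) x +
      ∑ c, Torus.dsize₃ (fun y => u s y c - u₁ s y c) x
    exact ((level3Rate_cont_dsize hδρ).2.2.add (level3Rate_cont_dsize hδθ).2.2).add
      (continuous_finsetSum _ fun c _ => (level3Rate_cont_dsize (hδuc c)).2.2)

/-- Summation of the per-word right-hand sides: `Σ_{lmn} [c (e_w + Y_w) + 3 N_w W R] = c · 10 e₃ + 3 N W R`. [folklore] -/
private theorem l3ir_sum_words (g a : Fin 3 → Fin 3 → Fin 3 → ℝ) (c W R : ℝ) :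
    ∑ n, ∑ m, ∑ l, (c * (g l m n + ∑ i, (g i m n + g l i n + g l m i)) + 3 * a l m n * W * R) =
      c * (10 * ∑ n, ∑ m, ∑ l, g l m n) + 3 * (∑ n, ∑ m, ∑ l, a l m n) * W * R := by
  simp only [Fin.sum_univ_three]
  ring

/-- The last bookkeeping step: absorbing the crude constants `Y ≤ X`, `Y cZ ≤ X` into the target shape. [folklore] -/
private theorem l3ir_final {I L E3 rE3 Cr Y X cZ s3 S P : ℝ} (hint : I ≤ L * E3 + Cr)
    (hcrude : Cr ≤ Y * ((S + cZ * s3) * E3 + (P + cZ * s3) * rE3)) (hYX : Y ≤ X) (hYcX : Y * cZ ≤ X)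
    (hE3 : 0 ≤ E3) (hrE3 : 0 ≤ rE3) (hP : 0 ≤ P) (hS : 0 ≤ S + cZ * s3) (hs3 : 0 ≤ s3) :
    I ≤ (L + X * (S + cZ * s3)) * E3 + X * (P + s3) * rE3 := by
  have k1 := mul_le_mul_of_nonneg_right hYX (mul_nonneg hS hE3)
  have k2 := mul_le_mul_of_nonneg_right hYX (mul_nonneg hP hrE3)
  have k3 := mul_le_mul_of_nonneg_right hYcX (mul_nonneg hs3 hrE3)
  nlinarith [k1, k2, k3]

/-- **Core estimate.** The integrated rate inequality at a time `t ∈ [0, T)` for a solution pair satisfying the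
pointwise hypotheses of the weak bootstrap regime (with `C_b = 1`) on all of `[0, T)`. [folklore] -/
private theorem l3ir_core :
    ∀ (K C cZ : ℝ), 0 < K → 0 ≤ C → 0 ≤ cZ →
      ∃ (Λ κ : ℝ) (a : ℕ), 0 ≤ Λ ∧ 0 < κ ∧
        ∀ {σ T T₁ cl pl : ℝ} {Cpoly ppoly : ℕ → ℝ} {ρ θ ρ₁ θ₁ : ℝ → T3 → ℝ} {u u₁ : ℝ → T3 → V3}
          {ζ : ℝ → ℝ} {J : Set ℝ},
          IsHardSphereEulerSolution σ T ρ u θ → IsHardSphereEulerSolution 0 T ρ₁ u₁ θ₁ →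
          0 < σ → σ ≤ 1 → T ≤ T₁ → 0 < cl → (∀ n, 0 ≤ Cpoly n) →
          IsOpen J → ContDiffOn ℝ (⊤ : ℕ∞) ζ J → (∀ t ∈ Ico 0 T, ∀ x, ρ t x ∈ J) →
          (∀ t ∈ Ico 0 T, ∀ x, hsPressure σ (ρ t x) (θ t x) = ρ t x * θ t x * ζ (ρ t x)) →
          (∀ t ∈ Ico 0 T, ∀ x, |ζ (ρ t x) - 1| ≤ cZ * (ρ t x * σ ^ 3) ∧
            |ρ t x * deriv ζ (ρ t x)| ≤ cZ * (ρ t x * σ ^ 3) ∧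
            |ρ t x ^ 2 * deriv (deriv ζ) (ρ t x)| ≤ cZ * (ρ t x * σ ^ 3)) →
          ShadowEosHigher cZ σ T ρ ζ →
          (∀ t ∈ Ico 0 T, ∀ x, θ₁ t x = K * ρ₁ t x ^ (2 / 3 : ℝ)) →
          (∀ t ∈ Ico 0 T, ∀ x, ∀ i : Fin 3,
            ‖Torus.partialDeriv i (u₁ t) x‖ ≤ C / (T₁ - t) ∧
            |Torus.partialDeriv i (fun y => ρ₁ t y ^ (1 / 3 : ℝ)) x| ≤ C / (T₁ - t)) →
          (∀ n : ℕ, n ≤ 6 → ∀ t ∈ Ico 0 T, ∀ y : EuclideanSpace ℝ (Fin 3),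
            ‖iteratedFDeriv ℝ n (Torus.lift (ρ₁ t)) y‖ ≤ Cpoly n * (T₁ - t) ^ (-ppoly n) ∧
            ‖iteratedFDeriv ℝ n (Torus.lift (u₁ t)) y‖ ≤ Cpoly n * (T₁ - t) ^ (-ppoly n)) →
          (∀ t ∈ Ico 0 T, ∀ x, cl * (T₁ - t) ^ pl ≤ ρ₁ t x) →
          (∀ t ∈ Ico 0 T, ∀ x, |ρ t x - ρ₁ t x| ≤ ρ₁ t x / 2 ∧ |θ t x - θ₁ t x| ≤ θ₁ t x / 2 ∧
            ρ t x * σ ^ 3 * (cZ + 1) ≤ 1 / 8) →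
          (∀ t ∈ Ico 0 T, ∀ x, ∀ i : Fin 3,
            ‖Torus.partialDeriv i (u t) x - Torus.partialDeriv i (u₁ t) x‖ ≤ 1 / (T₁ - t) ∧
            Real.sqrt (θ₁ t x) *
                |Torus.partialDeriv i (ρ t) x - Torus.partialDeriv i (ρ₁ t) x| / ρ₁ t x ≤ 1 / (T₁ - t) ∧
            |Torus.partialDeriv i (θ t) x - Torus.partialDeriv i (θ₁ t) x| / Real.sqrt (θ₁ t x) ≤ 1 / (T₁ - t)) →
          ∀ {t : ℝ}, t ∈ Ico 0 T → ∀ {S₀ S₁ : ℝ}, 0 ≤ S₀ → 0 ≤ S₁ →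
          (∀ x, l3m0 ρ θ ρ₁ θ₁ u u₁ t x ≤ S₀ ∧ l3m1 ρ θ ρ₁ θ₁ u u₁ t x ≤ S₁) →
          ∫ x, Torus.timeDerivWithin (Ico 0 T) (l3e3 ζ ρ θ ρ₁ θ₁ u u₁) t x ≤
            (Λ / (T₁ - t) + κ * l3base K cl pl T₁ Cpoly ppoly t ^ a * (S₀ + S₁ + cZ * σ ^ 3)) *
                shadowE3 ζ ρ θ u ρ₁ θ₁ u₁ t +
              κ * l3base K cl pl T₁ Cpoly ppoly t ^ a *
                (Real.sqrt (shadowE0 ζ ρ θ u ρ₁ θ₁ u₁ t) + Real.sqrt (shadowE1 ζ ρ θ u ρ₁ θ₁ u₁ t) +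
                  (1 + S₀ + S₁ + cZ * σ ^ 3) * Real.sqrt (shadowE2 ζ ρ θ u ρ₁ θ₁ u₁ t) + σ ^ 3) *
                Real.sqrt (shadowE3 ζ ρ θ u ρ₁ θ₁ u₁ t) := by
  intro K C cZ hK hC hcZ
  obtain ⟨Λb, hΛb, HB⟩ := level3_pointwise_balance K C 1 cZ hK hC zero_le_one hcZ
  obtain ⟨κe, ae, hκe, HE⟩ := level3_coefficient_envelope
  refine ⟨10 * Λb, 73 * 100000000 * (1 + κe * 2 ^ ae) ^ 3 * (1 + cZ), 3 * ae + 1, by positivity, by positivity, ?_⟩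
  intro σ T T₁ cl pl Cpoly ppoly ρ θ ρ₁ θ₁ u u₁ ζ J hE hE₁ hσ hσ1 hTT₁ hcl hCpoly hJ hζ hρJ hp hEos hEosH hisen hTI
    hpoly hfloor hB0 hB1 t ht S₀ S₁ hS₀ hS₁ hS
  have hlam : 0 < T₁ - t := sub_pos.2 (ht.2.trans_le hTT₁)
  have hU : UniqueDiffOn ℝ (Ico (0 : ℝ) T) := uniqueDiffOn_Ico 0 T
  -- the envelope constants
  obtain ⟨R₀, hR₀⟩ : ∃ R : ℝ, R = 576 * (1 + K) * (1 + ∑ n ∈ Finset.range 7, Cpoly n * (T₁ - t) ^ (-ppoly n)) ^ 5 *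
      (1 + (cl * (T₁ - t) ^ pl)⁻¹) ^ 5 := ⟨_, rfl⟩
  obtain ⟨B, hBd⟩ : ∃ B : ℝ, B = l3base K cl pl T₁ Cpoly ppoly t := ⟨_, rfl⟩
  obtain ⟨hR1, hRB, hB'⟩ := level3Rate_base (ppoly := ppoly) hK hcl hCpoly (ht.2.trans_le hTT₁) hR₀ hBd
  have hBone : 1 ≤ B := hR1.trans hRB
  have hBnn : 0 ≤ B := by linarith
  obtain ⟨Mv, hMvd⟩ : ∃ M : ℝ, M = 1 + κe * (2 * B) ^ ae := ⟨_, rfl⟩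
  have hpos : 0 ≤ κe * (2 * B) ^ ae := by positivity
  have hMv1 : 1 ≤ Mv := by rw [hMvd]; linarith
  have hMv0 : 0 < Mv := by linarith
  have hMvB : Mv ≤ (1 + κe * 2 ^ ae) * B ^ ae := by
    rw [hMvd, mul_pow, add_mul, one_mul]
    have h1 : 1 ≤ B ^ ae := one_le_pow₀ hBone
    have h2 : 0 ≤ κe * 2 ^ ae := by positivity
    nlinarith [mul_le_mul_of_nonneg_left h1 h2]
  have hMvle : κe * ((1 + 1) * (1 + K + K⁻¹) * R₀ * (1 + (T₁ - t)⁻¹)) ^ ae ≤ Mv := by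
    rw [hMvd, show (1 + 1) * (1 + K + K⁻¹) * R₀ * (1 + (T₁ - t)⁻¹) = 2 * B by rw [hB']; ring]
    linarith
  -- the envelope at every point, the regularity and the sizes
  have HEx := fun x => HE hE hE₁ hσ hσ1 hTT₁ hK hC zero_le_one hcZ hcl hJ hζ hρJ hEos hEosH hisen hTI hpoly hfloor
    hB0 hB1 ht (le_of_eq hR₀.symm) hMvle x
  obtain ⟨hδρ, hδθ, hδu, hword, hflux, he3st, he3c, cN, cm0, cm1, cq, cn⟩ := l3ir_regular hE hE₁ hJ hζ hρJ ht
  have ce0 := ((isSmoothSpaceTimeOn_shadowE0_integrand hE hE₁ hJ hζ hρJ).isSmooth_slice ht).continuous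
  have ce1 := ((isSmoothSpaceTimeOn_shadowE1_integrand hE hE₁ hJ hζ hρJ).isSmooth_slice ht).continuous
  have ce2 := ((isSmoothSpaceTimeOn_shadowE2_integrand hE hE₁ hJ hζ hρJ).isSmooth_slice ht).continuous
  have hP := fun x => level3Rate_sizes_pt (ζ := ζ) (ρ₁ := ρ₁) (θ₁ := θ₁) (x := x) hMv0 hδu
    (HEx x).1.1 (HEx x).1.2.2.1 (HEx x).1.2.2.2.2.1 rfl rfl rfl
  have hq4 := level3Rate_q4 hMv0 hδρ hδθ hδu he3c (fun x => (hS x).2)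
    (fun x => ⟨(HEx x).1.1, (HEx x).1.2.2.1, (HEx x).1.2.2.2.2.1⟩)
  -- nonnegativity of the sizes
  have hq0 : ∀ x, 0 ≤ l3q ρ θ ρ₁ θ₁ u u₁ t x := fun x => by
    unfold l3q
    exact add_nonneg (add_nonneg (Torus.dsize₂_nonneg _ _) (Torus.dsize₂_nonneg _ _))
      (Finset.sum_nonneg fun _ _ => Torus.dsize₂_nonneg _ _)
  have hn0 : ∀ x, 0 ≤ l3n ρ θ ρ₁ θ₁ u u₁ t x := fun x => by
    unfold l3n
    exact add_nonneg (add_nonneg (Torus.dsize₃_nonneg _ _) (Torus.dsize₃_nonneg _ _))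
      (Finset.sum_nonneg fun _ _ => Torus.dsize₃_nonneg _ _)
  have hN0 : ∀ x, 0 ≤ l3N3 ζ ρ θ ρ₁ θ₁ u u₁ t x := fun x => (l3m1_N3_nonneg (ζ := ζ)).2
  have hZ0 : 0 ≤ cZ * σ ^ 3 := by positivity
  obtain ⟨Rm, hRm⟩ : ∃ f : T3 → ℝ, ∀ x, f x = l3Rem Mv (cZ * σ ^ 3 * Mv) (18 * R₀ + l3q ρ θ ρ₁ θ₁ u u₁ t x)
      (54 * R₀ + l3n ρ θ ρ₁ θ₁ u u₁ t x) (l3m0 ρ θ ρ₁ θ₁ u u₁ t x) (l3m1 ρ θ ρ₁ θ₁ u u₁ t x) (l3q ρ θ ρ₁ θ₁ u u₁ t x) :=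
    ⟨_, fun x => rfl⟩
  -- the crude group, integrated
  obtain ⟨hLint, hcrude⟩ := level3Rate_crude_integral (R := R₀) (Zc := cZ * σ ^ 3) cN cm0 cm1 cq cn ce0 ce1 ce2 he3c hMv1
    (by linarith) hS₀ hS₁ hZ0 hN0 hq0 hn0 (fun x => (hP x).2.2.2.2.2.1.1) (fun x => (hP x).2.2.2.2.2.1.2.1)
    (fun x => (hP x).2.2.2.2.2.1.2.2.1) (fun x => (hP x).2.2.2.2.2.1.2.2.2) (fun x => (hS x).1) (fun x => (hS x).2)
    (fun x => (hP x).1) (fun x => (hP x).2.1) (fun x => (hP x).2.2.1) (fun x => (hP x).2.2.2.1)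
    (fun x => (hP x).2.2.2.2.1) hq4
  -- the pointwise balance summed over the words
  have hpt : ∀ x, Torus.timeDerivWithin (Ico 0 T) (l3e3 ζ ρ θ ρ₁ θ₁ u u₁) t x +
      ∑ n, ∑ m, ∑ l, ∑ i, Torus.partialDeriv i (l3flux ζ ρ θ ρ₁ θ₁ u u₁ t l m n i) x ≤
      10 * Λb / (T₁ - t) * l3e3 ζ ρ θ ρ₁ θ₁ u u₁ t x +
        3 * Mv * l3N3 ζ ρ θ ρ₁ θ₁ u u₁ t x * Rm x := by
    intro x
    have hD : Torus.timeDerivWithin (Ico 0 T) (l3e3 ζ ρ θ ρ₁ θ₁ u u₁) t x =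
        ∑ n, ∑ m, ∑ l, Torus.timeDerivWithin (Ico 0 T) (l3e ζ ρ θ ρ₁ θ₁ u u₁ l m n) t x := by
      have h := HasDerivWithinAt.fun_sum (u := Finset.univ) fun n _ =>
        HasDerivWithinAt.fun_sum (u := Finset.univ) fun m _ =>
          HasDerivWithinAt.fun_sum (u := Finset.univ) fun l _ => (hword l m n).hasDerivWithinAt_slice ht x
      exact h.derivWithin (hU t ht)
    have hRem0 : 0 ≤ Rm x := by
      rw [hRm]
      exact (l3Rem_mono hMv0.le le_rfl (by positivity) le_rfl (by linarith [hq0 x]) (by linarith [hn0 x]) l3m0_nonneg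
        le_rfl (l3m1_N3_nonneg (ζ := ζ)).1 le_rfl (hq0 x) le_rfl).1
    have hW := (HEx x).1.2.2.2.2.2.2
    have hWs0 : 0 ≤ l3Ws ζ ρ θ t x := by unfold l3Ws; positivity
    have hw3 : ∀ l m n, Torus.timeDerivWithin (Ico 0 T) (l3e ζ ρ θ ρ₁ θ₁ u u₁ l m n) t x +
        ∑ i, Torus.partialDeriv i (l3flux ζ ρ θ ρ₁ θ₁ u u₁ t l m n i) x ≤
        Λb / (T₁ - t) * (l3e ζ ρ θ ρ₁ θ₁ u u₁ l m n t x + l3Y ζ ρ θ ρ₁ θ₁ u u₁ t x l m n) +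
          3 * l3Nw ζ ρ θ ρ₁ θ₁ u u₁ t x l m n * l3Ws ζ ρ θ t x * Rm x := fun l m n => by
      rw [hRm]
      exact HB hE hE₁ hσ hTT₁ hJ hζ hρJ hp hEos hisen hTI hB0 hB1 ht x hMv0.le (by positivity) (by linarith [hq0 x])
        (by linarith [hn0 x]) l3m0_nonneg (l3m1_N3_nonneg (ζ := ζ)).1 (hq0 x) (HEx x).2 (level3Rate_jets t x) l m n
    have hsumw := l3ir_sum_words (fun l m n => l3e ζ ρ θ ρ₁ θ₁ u u₁ l m n t x)
      (fun l m n => l3Nw ζ ρ θ ρ₁ θ₁ u u₁ t x l m n) (Λb / (T₁ - t)) (l3Ws ζ ρ θ t x)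
      (Rm x)
    have he3x : 0 ≤ l3e3 ζ ρ θ ρ₁ θ₁ u u₁ t x := (hP x).2.2.2.2.2.1.2.2.2
    calc Torus.timeDerivWithin (Ico 0 T) (l3e3 ζ ρ θ ρ₁ θ₁ u u₁) t x +
          ∑ n, ∑ m, ∑ l, ∑ i, Torus.partialDeriv i (l3flux ζ ρ θ ρ₁ θ₁ u u₁ t l m n i) x
        = ∑ n, ∑ m, ∑ l, (Torus.timeDerivWithin (Ico 0 T) (l3e ζ ρ θ ρ₁ θ₁ u u₁ l m n) t x +
            ∑ i, Torus.partialDeriv i (l3flux ζ ρ θ ρ₁ θ₁ u u₁ t l m n i) x) := by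
          rw [hD]; simp only [Finset.sum_add_distrib]
      _ ≤ ∑ n, ∑ m, ∑ l, (Λb / (T₁ - t) * (l3e ζ ρ θ ρ₁ θ₁ u u₁ l m n t x + l3Y ζ ρ θ ρ₁ θ₁ u u₁ t x l m n) +
          3 * l3Nw ζ ρ θ ρ₁ θ₁ u u₁ t x l m n * l3Ws ζ ρ θ t x * Rm x) :=
          Finset.sum_le_sum fun n _ => Finset.sum_le_sum fun m _ => Finset.sum_le_sum fun l _ => hw3 l m n
      _ = Λb / (T₁ - t) * (10 * l3e3 ζ ρ θ ρ₁ θ₁ u u₁ t x) +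
          3 * l3N3 ζ ρ θ ρ₁ θ₁ u u₁ t x * l3Ws ζ ρ θ t x * Rm x := by
          simp only [l3Y]
          exact hsumw
      _ ≤ _ := by
          have h1 : 3 * l3N3 ζ ρ θ ρ₁ θ₁ u u₁ t x * l3Ws ζ ρ θ t x * Rm x ≤
              3 * l3N3 ζ ρ θ ρ₁ θ₁ u u₁ t x * Mv * Rm x :=
            mul_le_mul_of_nonneg_right (mul_le_mul_of_nonneg_left hW (by linarith [hN0 x])) hRem0
          have h2 : Λb / (T₁ - t) * (10 * l3e3 ζ ρ θ ρ₁ θ₁ u u₁ t x) =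
              10 * Λb / (T₁ - t) * l3e3 ζ ρ θ ρ₁ θ₁ u u₁ t x := by ring
          linarith
  -- integrate
  obtain ⟨hDint, hD0⟩ := level3Rate_div_zero (Φ := fun n m l i => l3flux ζ ρ θ ρ₁ θ₁ u u₁ t l m n i)
    (fun n m l i => hflux l m n i)
  have hdt : Integrable (Torus.timeDerivWithin (Ico 0 T) (l3e3 ζ ρ θ ρ₁ θ₁ u u₁) t) volume :=
    (he3st.isSmooth_timeDerivWithin hU ht).integrable
  have hE3i : Integrable (fun x => 10 * Λb / (T₁ - t) * l3e3 ζ ρ θ ρ₁ θ₁ u u₁ t x) volume :=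
    (continuous_const.mul he3c).integrable_unitAddTorus
  have hL1 : Integrable (fun x => Torus.timeDerivWithin (Ico 0 T) (l3e3 ζ ρ θ ρ₁ θ₁ u u₁) t x +
      ∑ n, ∑ m, ∑ l, ∑ i, Torus.partialDeriv i (l3flux ζ ρ θ ρ₁ θ₁ u u₁ t l m n i) x) volume := hdt.add hDint
  have hLint' : Integrable (fun x => 3 * Mv * l3N3 ζ ρ θ ρ₁ θ₁ u u₁ t x * Rm x) volume := by
    simpa only [hRm] using hLint
  have hR1i : Integrable (fun x => 10 * Λb / (T₁ - t) * l3e3 ζ ρ θ ρ₁ θ₁ u u₁ t x +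
      3 * Mv * l3N3 ζ ρ θ ρ₁ θ₁ u u₁ t x * Rm x) volume :=
    hE3i.add hLint'
  have hint := integral_mono hL1 hR1i hpt
  rw [integral_add hdt hDint, hD0, add_zero, integral_add hE3i hLint', integral_const_mul] at hint
  -- the named energies (`shadowE0/1/2` are definitionally the integrals appearing in `hcrude`)
  have eE3 : (∫ x, l3e3 ζ ρ θ ρ₁ θ₁ u u₁ t x) = shadowE3 ζ ρ θ u ρ₁ θ₁ u₁ t := rfl
  simp only [hRm] at hint
  rw [eE3] at hcrude hint
  -- absorb the constants into `κ B^a`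
  have hE30 : 0 ≤ shadowE3 ζ ρ θ u ρ₁ θ₁ u₁ t := by
    rw [← eE3]; exact integral_nonneg fun x => (hP x).2.2.2.2.2.1.2.2.2
  have hKM : 100000000 * Mv ^ 3 * (1 + 72 * R₀) ≤ 73 * 100000000 * (1 + κe * 2 ^ ae) ^ 3 * B ^ (3 * ae + 1) := by
    have h1 : Mv ^ 3 ≤ ((1 + κe * 2 ^ ae) * B ^ ae) ^ 3 := pow_le_pow_left₀ hMv0.le hMvB 3
    have h2 : 1 + 72 * R₀ ≤ 73 * B := by linarith
    calc 100000000 * Mv ^ 3 * (1 + 72 * R₀) ≤ 100000000 * ((1 + κe * 2 ^ ae) * B ^ ae) ^ 3 * (73 * B) :=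
          mul_le_mul (mul_le_mul_of_nonneg_left h1 (by norm_num)) h2 (by linarith) (by positivity)
      _ = 73 * 100000000 * (1 + κe * 2 ^ ae) ^ 3 * B ^ (3 * ae + 1) := by ring
  have hX0 : 0 ≤ 73 * 100000000 * (1 + κe * 2 ^ ae) ^ 3 * B ^ (3 * ae + 1) := by positivity
  have hXX : 73 * 100000000 * (1 + κe * 2 ^ ae) ^ 3 * B ^ (3 * ae + 1) ≤
      73 * 100000000 * (1 + κe * 2 ^ ae) ^ 3 * (1 + cZ) * B ^ (3 * ae + 1) := by
    calc 73 * 100000000 * (1 + κe * 2 ^ ae) ^ 3 * B ^ (3 * ae + 1)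
        = 73 * 100000000 * (1 + κe * 2 ^ ae) ^ 3 * B ^ (3 * ae + 1) * 1 := by ring
      _ ≤ 73 * 100000000 * (1 + κe * 2 ^ ae) ^ 3 * B ^ (3 * ae + 1) * (1 + cZ) :=
          mul_le_mul_of_nonneg_left (by linarith) hX0
      _ = _ := by ring
  have hYX := hKM.trans hXX
  have hYcX : 100000000 * Mv ^ 3 * (1 + 72 * R₀) * cZ ≤
      73 * 100000000 * (1 + κe * 2 ^ ae) ^ 3 * (1 + cZ) * B ^ (3 * ae + 1) := by
    calc 100000000 * Mv ^ 3 * (1 + 72 * R₀) * cZ ≤ 73 * 100000000 * (1 + κe * 2 ^ ae) ^ 3 * B ^ (3 * ae + 1) * cZ :=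
          mul_le_mul_of_nonneg_right hKM hcZ
      _ ≤ 73 * 100000000 * (1 + κe * 2 ^ ae) ^ 3 * B ^ (3 * ae + 1) * (1 + cZ) :=
          mul_le_mul_of_nonneg_left (by linarith) hX0
      _ = _ := by ring
  rw [← hBd]
  exact l3ir_final hint hcrude hYX hYcX hE30 (Real.sqrt_nonneg _) (by positivity) (by positivity) (by positivity)

/-- **Integrated level-3 rate inequality** (see the module docstring). [folklore] -/
theorem level3_integrated_rate :
    ∀ (K C cZ : ℝ), 0 < K → 0 ≤ C → 0 ≤ cZ →
      ∃ (Λ κ : ℝ) (a : ℕ), 0 ≤ Λ ∧ 0 < κ ∧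
        ∀ {T₁ cl pl σ T t₀ : ℝ} {Cpoly ppoly Cstat : ℕ → ℝ} {ρ θ ρ₁ θ₁ : ℝ → T3 → ℝ} {u u₁ : ℝ → T3 → V3}
          {ζ : ℝ → ℝ} {J : Set ℝ} {S₀ S₁ : ℝ → ℝ},
          0 < cl → (∀ n, 0 ≤ Cpoly n) →
          ShadowSetting K C cZ T₁ cl pl Cpoly ppoly Cstat σ T ρ θ ρ₁ θ₁ u u₁ ζ J → ShadowEosHigher cZ σ T ρ ζ →
          t₀ ∈ Ico 0 T → ShadowWeakBootstrap 1 (1 / (8 * (cZ + 1))) T₁ σ ρ θ u ρ₁ θ₁ u₁ t₀ →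
          (∀ s ∈ Icc 0 t₀, 0 ≤ S₀ s ∧ 0 ≤ S₁ s ∧
            ∀ x, l3m0 ρ θ ρ₁ θ₁ u u₁ s x ≤ S₀ s ∧ l3m1 ρ θ ρ₁ θ₁ u u₁ s x ≤ S₁ s) →
          ∀ s ∈ Ico 0 t₀,
            ∫ x, Torus.timeDerivWithin (Ico 0 T) (l3e3 ζ ρ θ ρ₁ θ₁ u u₁) s x ≤
              (Λ / (T₁ - s) + κ * l3base K cl pl T₁ Cpoly ppoly s ^ a * (S₀ s + S₁ s + cZ * σ ^ 3)) *
                  shadowE3 ζ ρ θ u ρ₁ θ₁ u₁ s +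
                κ * l3base K cl pl T₁ Cpoly ppoly s ^ a *
                  (Real.sqrt (shadowE0 ζ ρ θ u ρ₁ θ₁ u₁ s) + Real.sqrt (shadowE1 ζ ρ θ u ρ₁ θ₁ u₁ s) +
                    (1 + S₀ s + S₁ s + cZ * σ ^ 3) * Real.sqrt (shadowE2 ζ ρ θ u ρ₁ θ₁ u₁ s) + σ ^ 3) *
                  Real.sqrt (shadowE3 ζ ρ θ u ρ₁ θ₁ u₁ s) := by
  intro K C cZ hK hC hcZ
  obtain ⟨Λ, κ, a, hΛ, hκ, H⟩ := l3ir_core K C cZ hK hC hcZ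
  refine ⟨Λ, κ, a, hΛ, hκ, ?_⟩
  intro T₁ cl pl σ T t₀ Cpoly ppoly Cstat ρ θ ρ₁ θ₁ u u₁ ζ J S₀ S₁ hcl hCpoly hS hEosH ht₀ hWB hSS s hs
  obtain ⟨hE, hE₁, hσ, hσ1, _hT, hTT₁, hJ, hζ, hρJ, hp, hEos, hIsen, hTI, hpoly, hfloor, _hu0, _hθ0, _hstat⟩ := hS
  obtain ⟨hB0, hB1⟩ := hWB
  have ht₀T : t₀ ≤ T := ht₀.2.le
  have hsub : Ico 0 t₀ ⊆ Ico 0 T := Ico_subset_Ico_right ht₀T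
  have hsub' : Ico 0 t₀ ⊆ Icc 0 t₀ := Ico_subset_Icc_self
  have hE' : IsHardSphereEulerSolution σ t₀ ρ u θ := isHardSphereEulerSolution_restrict hE ht₀T
  have hE₁' : IsHardSphereEulerSolution 0 t₀ ρ₁ u₁ θ₁ := isHardSphereEulerSolution_restrict hE₁ ht₀T
  have hEosH' : ShadowEosHigher cZ σ t₀ ρ ζ := by
    unfold ShadowEosHigher at hEosH ⊢
    exact fun t ht x => hEosH t (hsub ht) x
  have hB0' : ∀ t ∈ Ico 0 t₀, ∀ x, |ρ t x - ρ₁ t x| ≤ ρ₁ t x / 2 ∧ |θ t x - θ₁ t x| ≤ θ₁ t x / 2 ∧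
      ρ t x * σ ^ 3 * (cZ + 1) ≤ 1 / 8 := by
    intro t ht x
    obtain ⟨h1, h2, h3⟩ := hB0 t (hsub' ht) x
    refine ⟨h1, h2, ?_⟩
    rw [le_div_iff₀ (by positivity)] at h3
    linarith
  have hSs := hSS s (hsub' hs)
  have key := H hE' hE₁' hσ hσ1 (ht₀T.trans hTT₁) hcl hCpoly hJ hζ (fun t ht x => hρJ t (hsub ht) x)
    (fun t ht x => hp t (hsub ht) x) (fun t ht x => hEos t (hsub ht) x) hEosH' (fun t ht x => hIsen t (hsub ht) x)
    (fun t ht x i => hTI t (hsub ht) x i) (fun n hn t ht y => hpoly n hn t (hsub ht) y)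
    (fun t ht x => hfloor t (hsub ht) x) hB0' (fun t ht x i => hB1 t (hsub' ht) x i) hs hSs.1 hSs.2.1 hSs.2.2
  have hconv : (∫ x, Torus.timeDerivWithin (Ico 0 T) (l3e3 ζ ρ θ ρ₁ θ₁ u u₁) s x) =
      ∫ x, Torus.timeDerivWithin (Ico 0 t₀) (l3e3 ζ ρ θ ρ₁ θ₁ u u₁) s x :=
    integral_congr_ae (ae_of_all _ fun x => (timeDerivWithin_Ico_eq_of_le hs ht₀T _ x).symm)
  rw [hconv]
  exact key

end Summit.AtomisticToContinuum.HydrodynamicLimit.Theorems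

end
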